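import Literature.NumberTheory.Automorphic.UnitaryLevelTwoLiftPieces            -- ★ F0P2-p01: ⊇ ★ `UnitaryLevelTwoInteriorRelabel` (`IsIntMatrix` tokens, `mem_cmLocalIntegralLevel_iff_isIntMatrix`, `isIntMatrix_inv_smul_iff`, `coe_localNonsplitEquiv_conj`), `IsLocSmooth`
import Literature.NumberTheory.Automorphic.IntMatrixLevelConjugation             -- ★ p08: `forall_v_conj_sub_one_apply_le_iff` (the level of `g − 1` is `Ad GL_N(𝒪)`-invariant)
import Literature.NumberTheory.Automorphic.MatrixMoebiusShiftInverse             -- ★ F0P2-p02: `moebius_neg_moebius`, `isUnit_det_neg_smul_moebius_add_smul_one` (the inverse Cayley shift)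
import Literature.NumberTheory.Automorphic.UnitaryDepthZeroPieceOrbitalIntegral  -- ★ A-p12: `isRegularElt_val_conj`, the unfolding frame ★ `OrbitalIntegralFixedPointWeighted`, instances on `(cmDatum L N H).Local v`
import Literature.NumberTheory.Automorphic.LocalRegularOrbitClosed               -- ★ `isClosed_conjClass_local_of_isRegularElt`
import Literature.NumberTheory.Automorphic.OrbitalIntegralSupportLocalisation    -- ★ `isLocSmooth_indicator_of_isClopen`
import Literature.NumberTheory.GaloisRepresentations.HeckeCharacter              -- ★ `HeckeCharacter.uniformizer` (the chart's `ϖ_v`)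
import HarnessLib

/-!
# Level-two interior orbital transport — the UNFOLDING HALF: both orbital integrals of N3 as finite fixed-coset sums, and the centraliser transport `Z(φ_c x) = Z(x)`
(Rogawski (1990) §4.9 Prop. 4.9.1 p. 55, §4.3 p. 43; Kottwitz (1986) §3)

Topic `NumberTheory/Automorphic`; namespace `Literature.NumberTheory.Automorphic`.  KERNEL mathematics only: theorems, no definition, no named fact, no instance,
no notation, no `sorry`.  Cell `pub/hodgecm-mathlib`, road «S3-tree», LIFT organ (I) `stub_liftInterior`, piece **N3 «THE `hF` SOCKET»** = F3
`classOrbitalIntegral_levelOneIndicator_eq_shift` (holder F0P2-p01 (g14); this file = the SECOND's half «both-sides finite unfolding + centraliser transport», architect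
A-154 (2); seat F0P3a-p04 (g17)).  HONEST LABEL: HC_CM is proved only modulo the 2 remaining named inputs (hLiu418, h413) until rung 0 closes; nothing printed is
discharged here.

THE MATHEMATICS.  `G′_v = U(H′)(L⁺_v)`, `K = U(H′)(𝒪_v)` hyperspecial (compact open), `v` non-split (`σ • w = w`), `ϖ = ϖ_v` read in `L_w`, `m_G` canonical for `(IsRegularElt, ν_G)`.
* §1 **CENTRALISER TRANSPORT UNDER THE CAYLEY SHIFT.**  For matrices, `Z M = M Z ⟹ Z φ(M) = φ(M) Z`, `φ(M) = (a M + b)(b M + a)⁻¹` (`det(bM + a)` a unit); with the inverse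
  shift `ψ = φ_{a,−b}` (★ `moebius_neg_moebius`, `a² − b²` a unit) this is an `iff`; hence for `x, y ∈ G′_v` with `y = φ_c(x)` as matrices (`c = ι(ϖ_v)`, `(c+1)² − (c−1)² = 4c`
  a unit of `∏ L_w`): **`Z_{G′_v}(y) = Z_{G′_v}(x)`** — so `Z(y)` is compact when `Z(x)` is.
* §2 **THE `y`-SIDE**: for `g′ ∈ C_c^∞` supported in `K` and `Ad K`-invariant, `y` regular with `y = φ_c(x)`, `Z(x)` compact:
  `Φ(⟦y⟧, g′) = ν_G(K) · Σ_{q ∈ Fix_y(G′_v⧸K)} g′(q̃⁻¹ y q̃)` (★ `classOrbitalIntegral_eq_sum_fixedBy_of_support_subset_of_conj_invariant` after §1).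
* §3 **THE `x`-SIDE WITH THE LEVEL-ONE CUT-OFF**: `S₁ = {x | x_w ≡ 1 (mod ϖ)}` is clopen and `Ad K`-stable (★ p08 `forall_v_conj_sub_one_apply_le_iff`), so `1_{S₁}·g` is again
  a `C_c^∞` `K`-class piece, and `Φ(⟦x⟧, 1_{S₁}·g) = ν_G(K) · Σ_{q ∈ Fix_x, q̃⁻¹xq̃ ≡ 1 (ϖ)} g(q̃⁻¹ x q̃)` — the interior fixed-coset sum in EXACTLY the token
  `{q | q ∈ Fix_x ∧ IsIntMatrix (ϖ⁻¹ • ((q̃⁻¹xq̃)_w − 1))}` of ★ `sum_fixedBy_interior_eq_sum_fixedBy_cayley_relabel` (so the holder relabels it to `Fix_y` by name).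
What is NOT here (the holder's half): the value identity `g(q̃⁻¹xq̃) = g′(q̃⁻¹yq̃)` on `Fix_y` (★ F1 p846643 + N2′) and the final `calc`.

## References
* [Rogawski1990] J. D. Rogawski, *Automorphic Representations of Unitary Groups in Three Variables*, Ann. of Math. Stud. 123 (1990), §4.9 Prop. 4.9.1 p. 55; §4.3 p. 43.
* [Kottwitz1986] R. E. Kottwitz, *Base change for unit elements of Hecke algebras*, Compositio Math. 60 (1986), §3.
* [Laumon1995] G. Laumon, *Cohomology of Drinfeld Modular Varieties* I (1996), Lemma (5.3.2) p. 136 (orbital integrals as lattice ∕ fixed-coset counts).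
* [HornJohnson2013] R. A. Horn, C. R. Johnson, *Matrix Analysis*, 2nd ed. (2013), §1.3 (commuting matrices and rational functions of a matrix).
-/

set_option autoImplicit false

noncomputable section

open NumberField IsDedekindDomain Matrix MeasureTheory Measure Topology Filter
open scoped MatrixGroups WithZero Valued

namespace Literature.NumberTheory.Automorphic

open UnitaryGroup Literature.NumberTheory.Rogawski1990 Literature.NumberTheory.Automorphic.MoebiusShift Literature.NumberTheory.Automorphic.UnitaryLatticeTree
  Literature.NumberTheory.GaloisRepresentations

/-! ## §1 Centraliser transport under the Cayley shift -/

section Matrices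

variable {R : Type*} [CommRing R] {n : Type*} [Fintype n] [DecidableEq n]

/-- `Z D = D Z` with `det D` a unit ⟹ `Z D⁻¹ = D⁻¹ Z`. [cite: HornJohnson2013, §1.3] -/
theorem commute_nonsing_inv_of_commute {Z D : Matrix n n R} (hD : IsUnit D.det) (h : Commute Z D) : Commute Z D⁻¹ := by
  have h1 : D⁻¹ * D = 1 := Matrix.nonsing_inv_mul D hD
  have h2 : D * D⁻¹ = 1 := Matrix.mul_nonsing_inv D hD
  change Z * D⁻¹ = D⁻¹ * Z
  calc Z * D⁻¹ = D⁻¹ * D * Z * D⁻¹ := by rw [h1, Matrix.one_mul]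
    _ = D⁻¹ * (D * Z) * D⁻¹ := by rw [Matrix.mul_assoc D⁻¹ D Z]
    _ = D⁻¹ * (Z * D) * D⁻¹ := by rw [h.eq]
    _ = D⁻¹ * Z * (D * D⁻¹) := by rw [← Matrix.mul_assoc, Matrix.mul_assoc (D⁻¹ * Z) D D⁻¹]
    _ = D⁻¹ * Z := by rw [h2, Matrix.mul_one]

/-- **`Z M = M Z ⟹ Z φ(M) = φ(M) Z`** for the Möbius ∕ Cayley shift `φ(M) = (a•M + b•1)(b•M + a•1)⁻¹` with invertible denominator. [cite: HornJohnson2013, §1.3] [cite: Kottwitz1986, §3] -/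
theorem commute_moebius_of_commute (Z M : Matrix n n R) (a b : R) (hD : IsUnit (b • M + a • (1 : Matrix n n R)).det) (h : Commute Z M) :
    Commute Z ((a • M + b • (1 : Matrix n n R)) * (b • M + a • (1 : Matrix n n R))⁻¹) := by
  have hN : Commute Z (a • M + b • (1 : Matrix n n R)) := (h.smul_right a).add_right ((Commute.one_right Z).smul_right b)
  have hDc : Commute Z (b • M + a • (1 : Matrix n n R)) := (h.smul_right b).add_right ((Commute.one_right Z).smul_right a)
  exact hN.mul_right (commute_nonsing_inv_of_commute hD hDc)

/-- **`Z M = M Z ⟺ Z φ(M) = φ(M) Z`** when moreover `a² − b²` is a unit (the inverse shift `ψ = φ_{a,−b}` undoes `φ`, ★ `moebius_neg_moebius`).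
[cite: HornJohnson2013, §1.3] [cite: Kottwitz1986, §3] -/
theorem commute_moebius_iff (Z M : Matrix n n R) {a b : R} (hab : IsUnit (a ^ 2 - b ^ 2)) (hD : IsUnit (b • M + a • (1 : Matrix n n R)).det) :
    Commute Z ((a • M + b • (1 : Matrix n n R)) * (b • M + a • (1 : Matrix n n R))⁻¹) ↔ Commute Z M := by
  refine ⟨fun h => ?_, commute_moebius_of_commute Z M a b hD⟩
  have h' := commute_moebius_of_commute Z _ a (-b) (isUnit_det_neg_smul_moebius_add_smul_one M hab hD) h
  rwa [moebius_neg_moebius M hab hD] at h'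

end Matrices

section Place

variable (L : Type) [Field L] [NumberField L] [IsCMField L] {N : ℕ} (H : Matrix (Fin N) (Fin N) L) {v : HeightOneSpectrum (𝓞 ↥(maximalRealSubfield L))}

/-- Two elements of `U(H)(L⁺_v)` commute iff their matrices do. [cite: PlatonovRapinchuk1994, §5.1] -/
theorem mul_eq_mul_iff_commute_coe (z x : (cmDatum L N H).Local v) :
    z * x = x * z ↔ Commute ((z.val : GL (Fin N) (LocalRing L v)).val : Matrix (Fin N) (Fin N) (LocalRing L v))
      ((x.val : GL (Fin N) (LocalRing L v)).val : Matrix (Fin N) (Fin N) (LocalRing L v)) := by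
  constructor
  · intro h
    exact congrArg (fun g : (cmDatum L N H).Local v => ((g.val : GL (Fin N) (LocalRing L v)).val : Matrix (Fin N) (Fin N) (LocalRing L v))) h
  · intro h
    exact Subtype.ext (Units.ext h.eq)

/-- **CENTRALISER TRANSPORT `Z(y) = Z(x)`** for `y = φ(x)` as matrices (`φ(X) = (a•X + b•1)(b•X + a•1)⁻¹`, `a² − b²` and `det(b•X + a•1)` units): an element of `U(H)(L⁺_v)`
commutes with `y` iff it commutes with `x`. [cite: HornJohnson2013, §1.3] [cite: Kottwitz1986, §3] -/
theorem centralizer_eq_of_coe_eq_moebius (x y : (cmDatum L N H).Local v) {a b : LocalRing L v} (hab : IsUnit (a ^ 2 - b ^ 2))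
    (hD : IsUnit ((b • ((x.val : GL (Fin N) (LocalRing L v)).val : Matrix (Fin N) (Fin N) (LocalRing L v)) + a • (1 : Matrix (Fin N) (Fin N) (LocalRing L v))).det))
    (hy : ((y.val : GL (Fin N) (LocalRing L v)).val : Matrix (Fin N) (Fin N) (LocalRing L v)) =
      (a • ((x.val : GL (Fin N) (LocalRing L v)).val : Matrix (Fin N) (Fin N) (LocalRing L v)) + b • 1) *
        (b • ((x.val : GL (Fin N) (LocalRing L v)).val : Matrix (Fin N) (Fin N) (LocalRing L v)) + a • 1)⁻¹) :
    Subgroup.centralizer ({y} : Set ((cmDatum L N H).Local v)) = Subgroup.centralizer ({x} : Set ((cmDatum L N H).Local v)) := by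
  ext z
  rw [Subgroup.mem_centralizer_singleton_iff, Subgroup.mem_centralizer_singleton_iff, mul_eq_mul_iff_commute_coe, mul_eq_mul_iff_commute_coe, hy]
  exact commute_moebius_iff _ _ hab hD

/-- At a non-split place (`σ • w = w`: `w` is the only place above `v`) an element of `∏_{w′∣v} L_{w′}` whose `w`-component is the uniformiser `ϖ_v` is a UNIT
(and so is `4c = (c+1)² − (c−1)²`). [cite: PlatonovRapinchuk1994, §5.1] -/
theorem isUnit_sq_sub_sq_of_apply_eq_toPlace_uniformizer (w : UnitaryGroup.PlacesOver L v) (hw : IsCMField.complexConj L • w.1 = w.1) {c : LocalRing L v}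
    (hcw : c w = toPlace v w (HeckeCharacter.uniformizer ↥(maximalRealSubfield L) v : v.adicCompletion ↥(maximalRealSubfield L))) :
    IsUnit ((c + 1) ^ 2 - (c - 1) ^ 2) := by
  haveI : Subsingleton (UnitaryGroup.PlacesOver L v) := PlacesOver.subsingleton_of_smul_eq (IsCMField.complexConj L) (IsCMField.complexConj_ne_one L) w hw
  have hϖ : (toPlace v w (HeckeCharacter.uniformizer ↥(maximalRealSubfield L) v : v.adicCompletion ↥(maximalRealSubfield L))) ≠ 0 :=
    (map_ne_zero (toPlace v w)).2 (Units.ne_zero _)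
  have hc0 : ∀ w' : UnitaryGroup.PlacesOver L v, c w' ≠ 0 := by
    intro w'
    obtain rfl : w' = w := Subsingleton.elim w' w
    rw [hcw]; exact hϖ
  have h4 : (c + 1) ^ 2 - (c - 1) ^ 2 = 4 * c := by ring
  rw [h4]
  refine isUnit_iff_exists_inv.2 ⟨fun w' => (4 * c w')⁻¹, funext fun w' => ?_⟩
  have h4' : (4 : w'.1.adicCompletion L) ≠ 0 := by norm_num
  change (4 * c) w' * (4 * c w')⁻¹ = 1
  rw [Pi.mul_apply, show (4 : LocalRing L v) w' = 4 from rfl, mul_inv_cancel₀ (mul_ne_zero h4' (hc0 w'))]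

end Place

/-! ## §2 The `y`-side: unfolding `Φ(⟦y⟧, g′)` at the Cayley-shifted class -/

section Unfold

variable (L : Type) [Field L] [NumberField L] [IsCMField L] (H' : Matrix (Fin 3) (Fin 3) L) {v : HeightOneSpectrum (𝓞 ↥(maximalRealSubfield L))}

/-- **THE `y`-SIDE OF N3: `Φ(⟦y⟧, g′) = ν_G(K) · Σ_{q ∈ Fix_y(G′_v⧸K)} g′(q̃⁻¹ y q̃)`** for `g′ ∈ C_c^∞(G′_v)` supported in `K = U(H′)(𝒪_v)` and `Ad K`-invariant, `y` REGULAR with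
`y = φ_c(x)` as matrices (`c_w = ϖ_v`, `det((c−1)x + (c+1))` a unit) and `Z(x)` COMPACT (so `Z(y) = Z(x)` is, §1): the weighted finite unfolding ★
`classOrbitalIntegral_eq_sum_fixedBy_of_support_subset_of_conj_invariant` at `y` (closed regular orbit ★ `isClosed_conjClass_local_of_isRegularElt`).
[cite: Rogawski1990, §4.9 Prop. 4.9.1 p. 55; §4.3 p. 43] [cite: Laumon1995, Lemma (5.3.2) p. 136] [cite: Kottwitz1986, §3] -/
theorem classOrbitalIntegral_eq_smul_finsum_fixedBy_of_coe_eq_moebius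
    (hH' : (H'.map (cmConjRingHom L)).transpose = H') (hdet : H'.det ≠ 0) (w : UnitaryGroup.PlacesOver L v)
    (hw : IsCMField.complexConj L • w.1 = w.1)
    [MeasurableSpace ((cmDatum L 3 H').Local v)] [BorelSpace ((cmDatum L 3 H').Local v)]
    [∀ γ : ((cmDatum L 3 H').Local v), MeasurableSpace (((cmDatum L 3 H').Local v) ⧸ Subgroup.centralizer ({γ} : Set ((cmDatum L 3 H').Local v)))]
    [∀ γ : ((cmDatum L 3 H').Local v), BorelSpace (((cmDatum L 3 H').Local v) ⧸ Subgroup.centralizer ({γ} : Set ((cmDatum L 3 H').Local v)))]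
    (νG : Measure ((cmDatum L 3 H').Local v)) [νG.IsHaarMeasure] [νG.IsMulRightInvariant] {mG : OrbitalMeasureFamily ((cmDatum L 3 H').Local v)}
    (hmG : mG.IsCanonical (fun γ => IsRegularElt (γ.val : GL (Fin 3) (UnitaryGroup.LocalRing L v))) νG)
    (c : LocalRing L v)
    (hcw : c w = toPlace v w (HeckeCharacter.uniformizer ↥(maximalRealSubfield L) v : v.adicCompletion ↥(maximalRealSubfield L)))
    (x y : (cmDatum L 3 H').Local v) (hyreg : IsRegularElt (y.val : GL (Fin 3) (UnitaryGroup.LocalRing L v)))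
    [CompactSpace (Subgroup.centralizer ({x} : Set ((cmDatum L 3 H').Local v)))]
    (hD : IsUnit ((c - 1) • ((x.val : GL (Fin 3) (LocalRing L v)).val : Matrix (Fin 3) (Fin 3) (LocalRing L v)) + (c + 1) • (1 : Matrix (Fin 3) (Fin 3) (LocalRing L v))).det)
    (hy : ((y.val : GL (Fin 3) (LocalRing L v)).val : Matrix (Fin 3) (Fin 3) (LocalRing L v)) =
      ((c + 1) • ((x.val : GL (Fin 3) (LocalRing L v)).val : Matrix (Fin 3) (Fin 3) (LocalRing L v)) + (c - 1) • 1) *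
        ((c - 1) • ((x.val : GL (Fin 3) (LocalRing L v)).val : Matrix (Fin 3) (Fin 3) (LocalRing L v)) + (c + 1) • 1)⁻¹)
    (g' : ((cmDatum L 3 H').Local v) → ℂ) (hg' : Rogawski1990.IsLocSmooth g') (hg'K : tsupport g' ⊆ (cmLocalIntegralLevel L 3 H' v : Set ((cmDatum L 3 H').Local v)))
    (hg'inv : ∀ u ∈ cmLocalIntegralLevel L 3 H' v, ∀ x, g' (u * x * u⁻¹) = g' x) :
    classOrbitalIntegral mG g' (ConjClasses.mk y) =
      νG.real (cmLocalIntegralLevel L 3 H' v : Set ((cmDatum L 3 H').Local v)) •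
        ∑ᶠ q ∈ MulAction.fixedBy ((cmDatum L 3 H').Local v ⧸ cmLocalIntegralLevel L 3 H' v) y, g' (q.out⁻¹ * y * q.out) := by
  -- `Z(y) = Z(x)` is compact (§1)
  have hZ := centralizer_eq_of_coe_eq_moebius L H' x y (isUnit_sq_sub_sq_of_apply_eq_toPlace_uniformizer L w hw hcw) hD hy
  haveI : CompactSpace (Subgroup.centralizer ({y} : Set ((cmDatum L 3 H').Local v))) := by rw [hZ]; infer_instance
  exact classOrbitalIntegral_eq_sum_fixedBy_of_support_subset_of_conj_invariant
    (P := fun γ : (cmDatum L 3 H').Local v => IsRegularElt (γ.val : GL (Fin 3) (LocalRing L v)))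
    (fun g₁ z hg₁ => isRegularElt_val_conj L 3 H' v g₁ z hg₁) hmG hyreg (cmLocalIntegralLevel L 3 H' v)
    (isCompact_isOpen_cmLocalIntegralLevel L 3 H' v).2 (isCompact_isOpen_cmLocalIntegralLevel L 3 H' v).1
    (isClosed_conjClass_local_of_isRegularElt L 3 H' v hH' hdet y hyreg) g' hg'.continuous ((subset_tsupport g').trans hg'K) hg'inv

/-! ## §3 The `x`-side: the level-one cut-off `1_{S₁}·g` is a `K`-class piece; its orbital integral is the interior fixed-coset sum -/

/-- The cut-off condition `x_w ≡ 1 (mod ϖ)` (entries of `ϖ⁻¹(x_w − 1)` integral, the indicator text of N3) IS `IsIntMatrix (ϖ⁻¹ • (x_w − 1))` (the token of ★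
`sum_fixedBy_interior_eq_sum_fixedBy_cayley_relabel`). [cite: Kottwitz1986, §3] -/
theorem forall_valued_inv_pow_one_mul_sub_le_one_iff_isIntMatrix (w : UnitaryGroup.PlacesOver L v) (hw : IsCMField.complexConj L • w.1 = w.1)
    (z : (cmDatum L 3 H').Local v) :
    (∀ a b, Valued.v (((toPlace v w (HeckeCharacter.uniformizer ↥(maximalRealSubfield L) v : v.adicCompletion ↥(maximalRealSubfield L))) ^ 1)⁻¹ *
        ((((localNonsplitEquiv (IsCMField.complexConj L) H' (IsCMField.complexConj_ne_one L) w hw z :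
            ↥(unitaryGroupOfForm (galAdicCompletionMap (L := L) (IsCMField.complexConj L) hw) (placeForm H' w.1))) : GL (Fin 3) (w.1.adicCompletion L)) :
              Matrix (Fin 3) (Fin 3) (w.1.adicCompletion L)) a b - (1 : Matrix (Fin 3) (Fin 3) (w.1.adicCompletion L)) a b)) ≤ 1) ↔
      IsIntMatrix ((toPlace v w (HeckeCharacter.uniformizer ↥(maximalRealSubfield L) v : v.adicCompletion ↥(maximalRealSubfield L)))⁻¹ •
        ((((localNonsplitEquiv (IsCMField.complexConj L) H' (IsCMField.complexConj_ne_one L) w hw z :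
            ↥(unitaryGroupOfForm (galAdicCompletionMap (L := L) (IsCMField.complexConj L) hw) (placeForm H' w.1))) : GL (Fin 3) (w.1.adicCompletion L)) :
              Matrix (Fin 3) (Fin 3) (w.1.adicCompletion L)) - 1)) := by
  refine forall_congr' fun a => forall_congr' fun b => ?_
  rw [pow_one, Matrix.smul_apply, Matrix.sub_apply, smul_eq_mul]

/-- `GL_N(𝒪)`-conjugation `g ↦ k⁻¹gk` preserves the level of `g − 1` (★ p08 `forall_v_conj_sub_one_apply_le_iff` at `k⁻¹`). [cite: Kottwitz1986, §3] -/
theorem forall_v_inv_conj_sub_one_apply_le_iff {K : Type*} [Field K] [Valued K ℤᵐ⁰] {N : ℕ} {k : GL (Fin N) K}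
    (hk : IsIntMatrix (k : Matrix (Fin N) (Fin N) K)) (hki : IsIntMatrix ((k⁻¹ : GL (Fin N) K) : Matrix (Fin N) (Fin N) K)) (g : GL (Fin N) K) (c : ℤᵐ⁰) :
    (∀ a b, Valued.v ((((k⁻¹ * g * k : GL (Fin N) K) : Matrix (Fin N) (Fin N) K) - 1) a b) ≤ c) ↔
      ∀ a b, Valued.v ((((g : GL (Fin N) K) : Matrix (Fin N) (Fin N) K) - 1) a b) ≤ c := by
  have h := forall_v_conj_sub_one_apply_le_iff (k := k⁻¹) hki (by rw [inv_inv]; exact hk) g c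
  rw [inv_inv] at h
  exact h

/-- **THE LEVEL-ONE CUT-OFF IS `Ad K`-STABLE**: for `k ∈ K` and any `z`, `k⁻¹zk ≡ 1 (mod ϖ)` at `w` iff `z ≡ 1 (mod ϖ)` (★ p08 `forall_v_conj_sub_one_apply_le_iff`, `k_w ∈ GL₃(𝒪_w)`).
[cite: Kottwitz1986, §3] [cite: Rogawski1990, §4.9 p. 55] -/
theorem inv_conj_mem_levelOneSet_iff (w : UnitaryGroup.PlacesOver L v) (hw : IsCMField.complexConj L • w.1 = w.1)
    {k : (cmDatum L 3 H').Local v} (hk : k ∈ cmLocalIntegralLevel L 3 H' v) (z : (cmDatum L 3 H').Local v) :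
    k⁻¹ * z * k ∈ {x : (cmDatum L 3 H').Local v | ∀ a b, Valued.v (((toPlace v w (HeckeCharacter.uniformizer ↥(maximalRealSubfield L) v : v.adicCompletion ↥(maximalRealSubfield L))) ^ 1)⁻¹ *
        ((((localNonsplitEquiv (IsCMField.complexConj L) H' (IsCMField.complexConj_ne_one L) w hw x :
            ↥(unitaryGroupOfForm (galAdicCompletionMap (L := L) (IsCMField.complexConj L) hw) (placeForm H' w.1))) : GL (Fin 3) (w.1.adicCompletion L)) :
              Matrix (Fin 3) (Fin 3) (w.1.adicCompletion L)) a b - (1 : Matrix (Fin 3) (Fin 3) (w.1.adicCompletion L)) a b)) ≤ 1} ↔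
    z ∈ {x : (cmDatum L 3 H').Local v | ∀ a b, Valued.v (((toPlace v w (HeckeCharacter.uniformizer ↥(maximalRealSubfield L) v : v.adicCompletion ↥(maximalRealSubfield L))) ^ 1)⁻¹ *
        ((((localNonsplitEquiv (IsCMField.complexConj L) H' (IsCMField.complexConj_ne_one L) w hw x :
            ↥(unitaryGroupOfForm (galAdicCompletionMap (L := L) (IsCMField.complexConj L) hw) (placeForm H' w.1))) : GL (Fin 3) (w.1.adicCompletion L)) :
              Matrix (Fin 3) (Fin 3) (w.1.adicCompletion L)) a b - (1 : Matrix (Fin 3) (Fin 3) (w.1.adicCompletion L)) a b)) ≤ 1} := by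
  have hϖ0 : (toPlace v w (HeckeCharacter.uniformizer ↥(maximalRealSubfield L) v : v.adicCompletion ↥(maximalRealSubfield L))) ≠ 0 :=
    (map_ne_zero (toPlace v w)).2 (Units.ne_zero _)
  obtain ⟨hkI, hkI'⟩ := (mem_cmLocalIntegralLevel_iff_isIntMatrix L 3 H' (IsCMField.complexConj_ne_one L) w hw k).1 hk
  rw [Set.mem_setOf_eq, Set.mem_setOf_eq, forall_valued_inv_pow_one_mul_sub_le_one_iff_isIntMatrix L H' w hw,
    forall_valued_inv_pow_one_mul_sub_le_one_iff_isIntMatrix L H' w hw, isIntMatrix_inv_smul_iff hϖ0, isIntMatrix_inv_smul_iff hϖ0,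
    coe_localNonsplitEquiv_conj L 3 H' (IsCMField.complexConj_ne_one L) w hw k z]
  exact forall_v_inv_conj_sub_one_apply_le_iff hkI hkI' _ _

/-- **THE LEVEL-ONE CUT-OFF IS CLOPEN** in `G′_v` (continuity of the one-place model `x ↦ x_w` ★ `localNonsplitEquiv` and of the entries; closed balls are clopen).
[cite: Kottwitz1986, §3] [cite: BernsteinZelevinsky1976, §1.1] -/
theorem isClopen_levelOneSet (w : UnitaryGroup.PlacesOver L v) (hw : IsCMField.complexConj L • w.1 = w.1) :
    IsClopen {x : (cmDatum L 3 H').Local v | ∀ a b, Valued.v (((toPlace v w (HeckeCharacter.uniformizer ↥(maximalRealSubfield L) v : v.adicCompletion ↥(maximalRealSubfield L))) ^ 1)⁻¹ *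
        ((((localNonsplitEquiv (IsCMField.complexConj L) H' (IsCMField.complexConj_ne_one L) w hw x :
            ↥(unitaryGroupOfForm (galAdicCompletionMap (L := L) (IsCMField.complexConj L) hw) (placeForm H' w.1))) : GL (Fin 3) (w.1.adicCompletion L)) :
              Matrix (Fin 3) (Fin 3) (w.1.adicCompletion L)) a b - (1 : Matrix (Fin 3) (Fin 3) (w.1.adicCompletion L)) a b)) ≤ 1} := by
  have hcont : Continuous fun x : (cmDatum L 3 H').Local v =>
      (((localNonsplitEquiv (IsCMField.complexConj L) H' (IsCMField.complexConj_ne_one L) w hw x :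
          ↥(unitaryGroupOfForm (galAdicCompletionMap (L := L) (IsCMField.complexConj L) hw) (placeForm H' w.1))) : GL (Fin 3) (w.1.adicCompletion L)) :
            Matrix (Fin 3) (Fin 3) (w.1.adicCompletion L)) :=
    Units.continuous_val.comp (continuous_subtype_val.comp (localNonsplitEquiv (IsCMField.complexConj L) H' (IsCMField.complexConj_ne_one L) w hw).continuous)
  have hset : {x : (cmDatum L 3 H').Local v | ∀ a b, Valued.v (((toPlace v w (HeckeCharacter.uniformizer ↥(maximalRealSubfield L) v : v.adicCompletion ↥(maximalRealSubfield L))) ^ 1)⁻¹ *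
        ((((localNonsplitEquiv (IsCMField.complexConj L) H' (IsCMField.complexConj_ne_one L) w hw x :
            ↥(unitaryGroupOfForm (galAdicCompletionMap (L := L) (IsCMField.complexConj L) hw) (placeForm H' w.1))) : GL (Fin 3) (w.1.adicCompletion L)) :
              Matrix (Fin 3) (Fin 3) (w.1.adicCompletion L)) a b - (1 : Matrix (Fin 3) (Fin 3) (w.1.adicCompletion L)) a b)) ≤ 1} =
      ⋂ a : Fin 3, ⋂ b : Fin 3, (fun x : (cmDatum L 3 H').Local v =>
        ((toPlace v w (HeckeCharacter.uniformizer ↥(maximalRealSubfield L) v : v.adicCompletion ↥(maximalRealSubfield L))) ^ 1)⁻¹ *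
          ((((localNonsplitEquiv (IsCMField.complexConj L) H' (IsCMField.complexConj_ne_one L) w hw x :
            ↥(unitaryGroupOfForm (galAdicCompletionMap (L := L) (IsCMField.complexConj L) hw) (placeForm H' w.1))) : GL (Fin 3) (w.1.adicCompletion L)) :
              Matrix (Fin 3) (Fin 3) (w.1.adicCompletion L)) a b - (1 : Matrix (Fin 3) (Fin 3) (w.1.adicCompletion L)) a b)) ⁻¹'
        ((Valued.v : Valuation (w.1.adicCompletion L) ℤᵐ⁰).integer : Set (w.1.adicCompletion L)) := by
    ext x
    simp only [Set.mem_setOf_eq, Set.mem_iInter, Set.mem_preimage, SetLike.mem_coe, Valuation.mem_integer_iff]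
  rw [hset]
  exact isClopen_iInter_of_finite fun a => isClopen_iInter_of_finite fun b =>
    (Valued.isClopen_integer (w.1.adicCompletion L)).preimage
      (continuous_const.mul ((((continuous_apply b).comp ((continuous_apply a).comp hcont))).sub continuous_const))

/-- **THE `x`-SIDE OF N3: `Φ(⟦x⟧, 1_{S₁}·g) = ν_G(K) · Σ_{q ∈ Fix_x, q̃⁻¹xq̃ ≡ 1 (ϖ)} g(q̃⁻¹ x q̃)`** for `g ∈ C_c^∞(G′_v)` supported in `K`, `Ad K`-invariant, `x` REGULAR with `Z(x)`
COMPACT, `S₁ = {z | z_w ≡ 1 (mod ϖ)}` the level-one cut-off (clopen, `Ad K`-stable — so `1_{S₁}·g` is again a `C_c^∞` `K`-class piece): the weighted finite unfolding ★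
`classOrbitalIntegral_eq_sum_fixedBy_of_support_subset_of_conj_invariant`, then the indicator restricts the fixed-coset sum to the INTERIOR cosets, written in the
`IsIntMatrix (ϖ⁻¹ • ((q̃⁻¹xq̃)_w − 1))` token of ★ `sum_fixedBy_interior_eq_sum_fixedBy_cayley_relabel`.
[cite: Rogawski1990, §4.9 Prop. 4.9.1 p. 55; §4.3 p. 43] [cite: Laumon1995, Lemma (5.3.2) p. 136] [cite: Kottwitz1986, §3] -/
theorem classOrbitalIntegral_levelOneIndicator_eq_smul_finsum_interior
    (hH' : (H'.map (cmConjRingHom L)).transpose = H') (hdet : H'.det ≠ 0) (w : UnitaryGroup.PlacesOver L v)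
    (hw : IsCMField.complexConj L • w.1 = w.1)
    [MeasurableSpace ((cmDatum L 3 H').Local v)] [BorelSpace ((cmDatum L 3 H').Local v)]
    [∀ γ : ((cmDatum L 3 H').Local v), MeasurableSpace (((cmDatum L 3 H').Local v) ⧸ Subgroup.centralizer ({γ} : Set ((cmDatum L 3 H').Local v)))]
    [∀ γ : ((cmDatum L 3 H').Local v), BorelSpace (((cmDatum L 3 H').Local v) ⧸ Subgroup.centralizer ({γ} : Set ((cmDatum L 3 H').Local v)))]
    (νG : Measure ((cmDatum L 3 H').Local v)) [νG.IsHaarMeasure] [νG.IsMulRightInvariant] {mG : OrbitalMeasureFamily ((cmDatum L 3 H').Local v)}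
    (hmG : mG.IsCanonical (fun γ => IsRegularElt (γ.val : GL (Fin 3) (UnitaryGroup.LocalRing L v))) νG)
    (x : (cmDatum L 3 H').Local v) (hxreg : IsRegularElt (x.val : GL (Fin 3) (UnitaryGroup.LocalRing L v)))
    [CompactSpace (Subgroup.centralizer ({x} : Set ((cmDatum L 3 H').Local v)))]
    (g : ((cmDatum L 3 H').Local v) → ℂ) (hg : Rogawski1990.IsLocSmooth g) (hgK : tsupport g ⊆ (cmLocalIntegralLevel L 3 H' v : Set ((cmDatum L 3 H').Local v)))
    (hginv : ∀ u ∈ cmLocalIntegralLevel L 3 H' v, ∀ x, g (u * x * u⁻¹) = g x) :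
    classOrbitalIntegral mG ({x : (cmDatum L 3 H').Local v | (∀ a b, Valued.v (((toPlace v w (HeckeCharacter.uniformizer ↥(maximalRealSubfield L) v : v.adicCompletion ↥(maximalRealSubfield L))) ^ 1)⁻¹ *
        ((((localNonsplitEquiv (IsCMField.complexConj L) H' (IsCMField.complexConj_ne_one L) w hw (x) :
            ↥(unitaryGroupOfForm (galAdicCompletionMap (L := L) (IsCMField.complexConj L) hw) (placeForm H' w.1))) : GL (Fin 3) (w.1.adicCompletion L)) :
              Matrix (Fin 3) (Fin 3) (w.1.adicCompletion L)) a b - (1 : Matrix (Fin 3) (Fin 3) (w.1.adicCompletion L)) a b)) ≤ 1)}.indicator g) (ConjClasses.mk x) =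
      νG.real (cmLocalIntegralLevel L 3 H' v : Set ((cmDatum L 3 H').Local v)) •
        ∑ᶠ q ∈ {q : (cmDatum L 3 H').Local v ⧸ cmLocalIntegralLevel L 3 H' v |
            q ∈ MulAction.fixedBy ((cmDatum L 3 H').Local v ⧸ cmLocalIntegralLevel L 3 H' v) x ∧
            IsIntMatrix ((toPlace v w (HeckeCharacter.uniformizer ↥(maximalRealSubfield L) v : v.adicCompletion ↥(maximalRealSubfield L)))⁻¹ •
              ((((localNonsplitEquiv (IsCMField.complexConj L) H' (IsCMField.complexConj_ne_one L) w hw (q.out⁻¹ * x * q.out) :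
                ↥(unitaryGroupOfForm (galAdicCompletionMap (L := L) (IsCMField.complexConj L) hw) (placeForm H' w.1))) : GL (Fin 3) (w.1.adicCompletion L)) :
                  Matrix (Fin 3) (Fin 3) (w.1.adicCompletion L)) - 1))},
          g (q.out⁻¹ * x * q.out) := by
  -- the cut-off piece `1_{S₁}·g` is `C_c^∞`, supported in `K`, `Ad K`-invariant
  set S₁ : Set ((cmDatum L 3 H').Local v) := {x : (cmDatum L 3 H').Local v | (∀ a b, Valued.v (((toPlace v w (HeckeCharacter.uniformizer ↥(maximalRealSubfield L) v : v.adicCompletion ↥(maximalRealSubfield L))) ^ 1)⁻¹ *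
        ((((localNonsplitEquiv (IsCMField.complexConj L) H' (IsCMField.complexConj_ne_one L) w hw (x) :
            ↥(unitaryGroupOfForm (galAdicCompletionMap (L := L) (IsCMField.complexConj L) hw) (placeForm H' w.1))) : GL (Fin 3) (w.1.adicCompletion L)) :
              Matrix (Fin 3) (Fin 3) (w.1.adicCompletion L)) a b - (1 : Matrix (Fin 3) (Fin 3) (w.1.adicCompletion L)) a b)) ≤ 1)} with hS₁
  have hS₁c : IsClopen S₁ := isClopen_levelOneSet L H' w hw
  have hf : Rogawski1990.IsLocSmooth (S₁.indicator g) := isLocSmooth_indicator_of_isClopen hg hS₁c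
  have hfK : Function.support (S₁.indicator g) ⊆ (cmLocalIntegralLevel L 3 H' v : Set ((cmDatum L 3 H').Local v)) := by
    intro z hz
    rw [Set.support_indicator] at hz
    exact hgK (subset_tsupport g hz.2)
  have hfinv : ∀ u ∈ cmLocalIntegralLevel L 3 H' v, ∀ z, (S₁.indicator g) (u * z * u⁻¹) = (S₁.indicator g) z := by
    intro u hu z
    have hz' : u⁻¹ * (u * z * u⁻¹) * u = z := by group
    have key : u * z * u⁻¹ ∈ S₁ ↔ z ∈ S₁ := by
      have h := inv_conj_mem_levelOneSet_iff L H' w hw hu (u * z * u⁻¹)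
      rw [hz'] at h
      exact h.symm
    by_cases hz : z ∈ S₁
    · rw [Set.indicator_of_mem hz, Set.indicator_of_mem (key.2 hz), hginv u hu z]
    · rw [Set.indicator_of_notMem hz, Set.indicator_of_notMem (fun h => hz (key.1 h))]
  rw [classOrbitalIntegral_eq_sum_fixedBy_of_support_subset_of_conj_invariant
    (P := fun γ : (cmDatum L 3 H').Local v => IsRegularElt (γ.val : GL (Fin 3) (LocalRing L v)))
    (fun g₁ z hg₁ => isRegularElt_val_conj L 3 H' v g₁ z hg₁) hmG hxreg (cmLocalIntegralLevel L 3 H' v)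
    (isCompact_isOpen_cmLocalIntegralLevel L 3 H' v).2 (isCompact_isOpen_cmLocalIntegralLevel L 3 H' v).1
    (isClosed_conjClass_local_of_isRegularElt L 3 H' v hH' hdet x hxreg) (S₁.indicator g) hf.continuous hfK hfinv]
  congr 1
  -- the indicator restricts the fixed-coset sum to the interior cosets
  rw [finsum_mem_def, finsum_mem_def]
  refine finsum_congr fun q => ?_
  by_cases hq : q ∈ MulAction.fixedBy ((cmDatum L 3 H').Local v ⧸ cmLocalIntegralLevel L 3 H' v) x
  · by_cases hq' : q.out⁻¹ * x * q.out ∈ S₁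
    · have hmem : q ∈ {q : (cmDatum L 3 H').Local v ⧸ cmLocalIntegralLevel L 3 H' v |
          q ∈ MulAction.fixedBy ((cmDatum L 3 H').Local v ⧸ cmLocalIntegralLevel L 3 H' v) x ∧
          IsIntMatrix ((toPlace v w (HeckeCharacter.uniformizer ↥(maximalRealSubfield L) v : v.adicCompletion ↥(maximalRealSubfield L)))⁻¹ •
            ((((localNonsplitEquiv (IsCMField.complexConj L) H' (IsCMField.complexConj_ne_one L) w hw (q.out⁻¹ * x * q.out) :
              ↥(unitaryGroupOfForm (galAdicCompletionMap (L := L) (IsCMField.complexConj L) hw) (placeForm H' w.1))) : GL (Fin 3) (w.1.adicCompletion L)) :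
                Matrix (Fin 3) (Fin 3) (w.1.adicCompletion L)) - 1))} :=
        ⟨hq, (forall_valued_inv_pow_one_mul_sub_le_one_iff_isIntMatrix L H' w hw _).1 hq'⟩
      rw [Set.indicator_of_mem hq, Set.indicator_of_mem hmem, Set.indicator_of_mem hq']
    · have hnmem : q ∉ {q : (cmDatum L 3 H').Local v ⧸ cmLocalIntegralLevel L 3 H' v |
          q ∈ MulAction.fixedBy ((cmDatum L 3 H').Local v ⧸ cmLocalIntegralLevel L 3 H' v) x ∧
          IsIntMatrix ((toPlace v w (HeckeCharacter.uniformizer ↥(maximalRealSubfield L) v : v.adicCompletion ↥(maximalRealSubfield L)))⁻¹ •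
            ((((localNonsplitEquiv (IsCMField.complexConj L) H' (IsCMField.complexConj_ne_one L) w hw (q.out⁻¹ * x * q.out) :
              ↥(unitaryGroupOfForm (galAdicCompletionMap (L := L) (IsCMField.complexConj L) hw) (placeForm H' w.1))) : GL (Fin 3) (w.1.adicCompletion L)) :
                Matrix (Fin 3) (Fin 3) (w.1.adicCompletion L)) - 1))} :=
        fun h => hq' ((forall_valued_inv_pow_one_mul_sub_le_one_iff_isIntMatrix L H' w hw _).2 h.2)
      rw [Set.indicator_of_mem hq, Set.indicator_of_notMem hnmem, Set.indicator_of_notMem hq']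
  · have hnmem : q ∉ {q : (cmDatum L 3 H').Local v ⧸ cmLocalIntegralLevel L 3 H' v |
        q ∈ MulAction.fixedBy ((cmDatum L 3 H').Local v ⧸ cmLocalIntegralLevel L 3 H' v) x ∧
        IsIntMatrix ((toPlace v w (HeckeCharacter.uniformizer ↥(maximalRealSubfield L) v : v.adicCompletion ↥(maximalRealSubfield L)))⁻¹ •
          ((((localNonsplitEquiv (IsCMField.complexConj L) H' (IsCMField.complexConj_ne_one L) w hw (q.out⁻¹ * x * q.out) :
            ↥(unitaryGroupOfForm (galAdicCompletionMap (L := L) (IsCMField.complexConj L) hw) (placeForm H' w.1))) : GL (Fin 3) (w.1.adicCompletion L)) :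
              Matrix (Fin 3) (Fin 3) (w.1.adicCompletion L)) - 1))} := fun h => hq h.1
    rw [Set.indicator_of_notMem hq, Set.indicator_of_notMem hnmem]

end Unfold

end Literature.NumberTheory.Automorphic

end
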